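import Summits.Schanuel.Statement
import Literature.NumberTheory.Transcendental.RoyCriterion

/-!
# Schanuel / RoyCriterion — assembly

Route `Schanuel/RoyCriterion`, item `stmt-Schanuel-0464` (typed assembly; supersedes
`stmt-Schanuel-0079`): with Roy's equivalence `Roy2001_iff : ∀ l, RoyCriterion l ↔ SchanuelRank l`
(Roy 2001, §1 and Thm. 1) as a hypothesis, Roy's arithmetic criterion for every rank implies
Schanuel's conjecture. `Schanuel` unfolds to `∀ l, SchanuelRank l` verbatim.
-/

namespace Literature.Transcend

/-- `Schanuel` is, definitionally, Roy's Conjecture 1 for every rank. [folklore] -/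
theorem schanuel_iff_forall_schanuelRank : Schanuel ↔ ∀ l, Literature.NumberTheory.Transcendental.SchanuelRank l := Iff.rfl

/-- Settles `stmt-Schanuel-0464` (assembly): Roy's equivalence (Roy 2001, Thm. 1, taken as the
hypothesis `Roy2001_iff`) and Roy's criterion for every rank give Schanuel's conjecture.
[folklore] -/
theorem roy2001_iff_imp_royCriterion_imp_schanuel :
    Literature.NumberTheory.Transcendental.Roy2001_iff → (∀ n, Literature.NumberTheory.Transcendental.RoyCriterion n) → Schanuel :=
  fun h hR n => (h n).mp (hR n)

end Literature.Transcend
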